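import Summits.Ventures.DiscreteObjects.PP12.FlagSevenOrbitReduction
import Summits.Ventures.DiscreteObjects.PP12.FlagTenOrbitReduction
import Summits.Ventures.DiscreteObjects.PP12.NoPlanarOrderThreeCensus

/-!
# PP(12) order-3 census: the rigid endgame with both flag reductions (kernel; bookkeeping)
Framing: lottery ticket; floor = certified bounds/negative ranges.

Cell pub-namedobj (venture DiscreteObjects), target (M), designs gen 14. `card_collineationGroup_eq_one_v7`: `FlagSubcells.card_collineationGroup_eq_one_v5`
with the two flag sub-cell hypotheses `f = 7` and `f = 10` replaced by their FINITE orbit-matrix statements, via the kernel reductions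
`flagSevenOrbitReduction_holds` (`FlagSevenOrbitReduction`) and `flagTenOrbitReduction_holds` (`FlagTenOrbitReduction`, p341074). Census status
2026-08-22: `hF1`, `hF4` 'typed / undecided'; `hF7 = NoFlagSevenOrbitMatrix` UNDECIDED; `hF10 = NoFlagTenOrbitMatrix` decided EMPTY by two independent
computations outside the kernel; `hJvT` a named fact (Janko–van Trung 1982); `h2`, `h3E` the array statements of the involution / order-3 elation cells.
Also `noFlagOrder3_of_orbitMatrices` and `noOrderThree_of_finite_statements` (the whole live cell `|G| = 3` from finite statements + the planar theorem).
Nothing here asserts any of the hypotheses. No `sorry`, no new axioms.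
-/

namespace Summit.Ventures.DiscreteObjects.PP12

open Configuration Finset
open scoped Classical

open Literature.Combinatorics.Designs Summit.Ventures.DiscreteObjects.STD in
/-- **Rigid endgame, v7:** Janko–van Trung's `{2,3}`-group theorem (named fact), the array statements of the involution and order-3 elation cells, the
typed flag sub-cells `f = 1, 4`, and the two orbit-matrix statements `NoFlagSevenOrbitMatrix`, `NoFlagTenOrbitMatrix` force every collineation group of a
projective plane of order 12 to be trivial. -/
theorem card_collineationGroup_eq_one_v7 (hJvT : CollineationGroupIsTwoThreeGroup)
    (h2 : NoLiftableSTD2_12_6) (h3E : NoLiftableSTD3_12_4)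
    (hF1 : NoFlagOrder3Order12Fixed 1) (hF4 : NoFlagOrder3Order12Fixed 4)
    (hF7 : NoFlagSevenOrbitMatrix) (hF10 : NoFlagTenOrbitMatrix)
    (P L : Type) [Membership P L] [Fintype P] [Fintype L] [ProjectivePlane P L] (h12 : ProjectivePlane.order P L = 12)
    (G : Type) [Group G] [Fintype G] [MulAction G P] [MulAction G L] (hG : IsCollineationGroup G P L) :
    Fintype.card G = 1 :=
  card_collineationGroup_eq_one_v6 hJvT h2 h3E hF1 hF4 (noFlagSevenFixed_of_noOrbitMatrix hF7) hF10 P L h12 G hG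

/-- **The order-3 flag cell, reduced:** with the two orbit-matrix statements and the typed sub-cells `f = 1, 4`, no projective plane of order 12 admits a
flag-type collineation of order 3 (`LiveCellsOrder3.NoFlagOrder3Order12` via `FlagSubcells.flag_subcells`). -/
theorem noFlagOrder3_of_orbitMatrices (hF1 : NoFlagOrder3Order12Fixed 1) (hF4 : NoFlagOrder3Order12Fixed 4)
    (hF7 : NoFlagSevenOrbitMatrix) (hF10 : NoFlagTenOrbitMatrix) : NoFlagOrder3Order12 :=
  flag_subcells.mpr ⟨hF1, hF4, noFlagSevenFixed_of_noOrbitMatrix hF7, noFlagTenFixed_of_noOrbitMatrix hF10⟩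

open Literature.Combinatorics.Designs Summit.Ventures.DiscreteObjects.STD in
/-- **The live cell `|G| = 3`, reduced to finite statements:** the array statement of the order-3 elation sub-cell, the typed flag sub-cells `f = 1, 4`,
the two orbit-matrix statements, and the planar sub-cell — a THEOREM (`noPlanarOrder3Order12`, Roth 1964 replication) — give `NoOrderThreeOrder12`
(`LiveCellsOrder3.noOrderThree_of_arrays`). Census status: `hE` decided EMPTY outside the kernel (cell rows), `hF1`/`hF4`/`hF7` undecided, `hF10` decided
EMPTY outside the kernel. -/
theorem noOrderThree_of_finite_statements (hE : NoLiftableSTD3_12_4) (hF1 : NoFlagOrder3Order12Fixed 1) (hF4 : NoFlagOrder3Order12Fixed 4)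
    (hF7 : NoFlagSevenOrbitMatrix) (hF10 : NoFlagTenOrbitMatrix) : NoOrderThreeOrder12 :=
  noOrderThree_of_arrays hE noPlanarOrder3Order12 (noFlagOrder3_of_orbitMatrices hF1 hF4 hF7 hF10)

end Summit.Ventures.DiscreteObjects.PP12
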